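import Mathlib
import Summits.Ventures.HodgeRepro.Tier4.Common.RowWeights
import Summits.Ventures.HodgeRepro.Tier4.Common.LocalTorusCompact
import Summits.Ventures.HodgeRepro.Tier4.Common.CompactHaarProbability
import Summits.Ventures.HodgeRepro.Tier4.Line4.KTypeOfPeriodClosed

/-!
# Tier4/Line4/KTypeOfPeriodRow — C-L4-KTYPE on a ROW PLANE: every displayed clause of `KTypeOfPeriodClosed` bound by name

Blind re-derivation cell `pub-hodge-repro`, Tier 4 «prove the step» (README §9–§10), seat t4-L4-p1 (prover, LINE L4,
gen 3).  Tree path `lean/Summits/Ventures/HodgeRepro/Tier4/Line4/KTypeOfPeriodRow.lean`.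

WHAT IS PROVED.  `hasKTypeAt_of_period_ne_zero_row`: on the row plane `PlaneData.ofLinesRow q a b ε` (`a b ε ≠ 0`) at a
real place `w` with the CM inequality `IsCMAt q w`, for a closed invariant subspace `U` of `Setting.ofAdelicData` and
`f ∈ span ℂ U` with non-zero `T`-period against a continuous unitary character `R.chi` matching the weight at `w`, the
span of `U` has the `K`-type `(e₊ w, e₋ w)` at `w`.  The displays of `KTypeOfPeriodClosed.hasKTypeAt_of_period_ne_zero_span`
are all theorems of typer-2's Common modules on a row plane: the compactness of the local torus
(`compactSpace_localTorusAt_ofLinesRow`, LocalTorusCompact), the multiplicativity / unit modulus of the weight character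
(`weightChar_localTorusAt_mul`, `norm_weightChar_localTorusAt_eq_one`, RowWeights) and its continuity
(`continuous_weightAt`), the right invariance of the torus Haar measure (`isMulRightInvariant_torusT_ofLinesRow`,
RowTorus: the torus of a row plane is commutative), and the Haar probability of the local torus (`haarProb`,
CompactHaarProbability).  What stays displayed is DATA: the cocompactness data of `Setting.ofAdelicData`, the unitary
continuous character `R.chi` and its exponent compatibility `ChiMatchesAt`, the non-vanishing of the period.

Nothing here says anything about the status of the Hodge conjecture for CM abelian varieties, which is NOT proved
(HC_CM is NOT proved by anyone in this repository).
-/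

set_option autoImplicit false

noncomputable section

namespace Summit.Ventures.HodgeRepro.Tier4.Line4

open Summit.Ventures.HodgeRepro.Tier4.Common Summit.Ventures.HodgeRepro.Tier4.Line1 MeasureTheory NumberField
open scoped ComplexConjugate

section Row

variable {k : Type} [Field k] [NumberField k] (q : QuadData k) (a b ε : k)
  [MeasurableSpace (GA (PlaneData.ofLinesRow q a b ε))] [BorelSpace (GA (PlaneData.ofLinesRow q a b ε))]
  (R : RTFData (PlaneData.ofLinesRow q a b ε)) (μ : Measure (GA (PlaneData.ofLinesRow q a b ε)))
  [μ.IsHaarMeasure] [R.μT.IsHaarMeasure] [R.μT'.IsHaarMeasure]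
  (DG : Set (GA (PlaneData.ofLinesRow q a b ε)))
  (fdG : IsFundamentalDomain (rationalPoints (PlaneData.ofLinesRow q a b ε)) DG μ) (compG : IsCompact (closure DG))
  (compT : IsCompact (closure R.DT)) (compT' : IsCompact (closure R.DT'))

omit [MeasurableSpace (GA (PlaneData.ofLinesRow q a b ε))] [BorelSpace (GA (PlaneData.ofLinesRow q a b ε))] in
/-- **The weight character of a row plane is continuous on the local torus** (the `hχc` clause of `KTypeOfPeriod`):
its two factors are continuous and non-vanishing there (unit modulus). -/
theorem continuous_weightChar_localTorusAt (ha : a ≠ 0) (hb : b ≠ 0) (hε : ε ≠ 0) {w : InfinitePlace k}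
    (hw : w.IsReal) (hcm : IsCMAt q w) (ePlus eMinus : ℤ) :
    Continuous fun κ : localTorusAt (PlaneData.ofLinesRow q a b ε) w =>
      weightAt (PlaneData.ofLinesRow q a b ε) q w 0 κ ^ ePlus *
        weightAt (PlaneData.ofLinesRow q a b ε) q w 1 κ ^ eMinus := by
  have h0 : Continuous fun κ : localTorusAt (PlaneData.ofLinesRow q a b ε) w =>
      weightAt (PlaneData.ofLinesRow q a b ε) q w 0 κ :=
    (continuous_weightAt q w (PlaneData.ofLinesRow q a b ε) 0).comp continuous_subtype_val
  have h1 : Continuous fun κ : localTorusAt (PlaneData.ofLinesRow q a b ε) w =>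
      weightAt (PlaneData.ofLinesRow q a b ε) q w 1 κ :=
    (continuous_weightAt q w (PlaneData.ofLinesRow q a b ε) 1).comp continuous_subtype_val
  have hne : ∀ (j : Fin 2) (κ : localTorusAt (PlaneData.ofLinesRow q a b ε) w),
      weightAt (PlaneData.ofLinesRow q a b ε) q w j κ ≠ 0 := by
    intro j κ h
    have := norm_weightAt_localTorusAt_eq_one q a b ε w ha hb hε hw hcm j w κ κ.2
    rw [h, norm_zero] at this
    exact zero_ne_one this
  exact (h0.zpow₀ ePlus fun κ => Or.inl (hne 0 κ)).mul (h1.zpow₀ eMinus fun κ => Or.inl (hne 1 κ))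

/-- **C-L4-KTYPE on a row plane, every display bound by name**: `P_χ(f) ≠ 0` for `f ∈ span ℂ U` (`U` closed invariant)
gives the `K`-type `(e₊ w, e₋ w)` of `T` at the real CM place `w` on `span ℂ U`. -/
theorem hasKTypeAt_of_period_ne_zero_row (ha : a ≠ 0) (hb : b ≠ 0) (hε : ε ≠ 0) {w : InfinitePlace k}
    (hw : w.IsReal) (hcm : IsCMAt q w) (eP eM : InfinitePlace k → ℤ)
    (hu : ∀ t, ‖R.chi t‖ = 1) (hc : Continuous R.chi)
    (hmatch : ChiMatchesAt (PlaneData.ofLinesRow q a b ε) q w (eP w) (eM w) R.chi)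
    {U : Set (GA (PlaneData.ofLinesRow q a b ε) → ℂ)}
    (hU : (Setting.ofAdelicData (PlaneData.ofLinesRow q a b ε) R μ DG fdG compG compT compT').IsInvariantSubspace U)
    (hcl : IsClosedSub (Setting.ofAdelicData (PlaneData.ofLinesRow q a b ε) R μ DG fdG compG compT compT') U)
    {f : GA (PlaneData.ofLinesRow q a b ε) → ℂ} (hf : f ∈ Submodule.span ℂ U)
    (hP : periodLin (PlaneData.ofLinesRow q a b ε) R.μT R.DT R.chi
      (restrictTo (PlaneData.ofLinesRow q a b ε) (torusT (PlaneData.ofLinesRow q a b ε)) f) ≠ 0) :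
    HasKTypeAt (PlaneData.ofLinesRow q a b ε) q w (eP w) (eM w) (Submodule.span ℂ U) := by
  haveI : R.μT.IsMulRightInvariant := isMulRightInvariant_torusT_ofLinesRow q a b ε ha hb hε R.μT
  haveI : CompactSpace (localTorusAt (PlaneData.ofLinesRow q a b ε) w) :=
    compactSpace_localTorusAt_ofLinesRow q a b ε ha hb hε hw hcm
  haveI := isHaarMeasure_haarProb (localTorusAt (PlaneData.ofLinesRow q a b ε) w)
  haveI := isProbabilityMeasure_haarProb (localTorusAt (PlaneData.ofLinesRow q a b ε) w)
  exact hasKTypeAt_of_period_ne_zero_span (PlaneData.ofLinesRow q a b ε) R μ DG fdG compG compT compT' w q eP eM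
    (haarProb (localTorusAt (PlaneData.ofLinesRow q a b ε) w)) hu hc
    (weightChar_localTorusAt_mul q a b ε w ha hb hε hw hcm (eP w) (eM w) w)
    (continuous_weightChar_localTorusAt q a b ε ha hb hε hw hcm (eP w) (eM w))
    (fun κ => norm_weightChar_localTorusAt_eq_one q a b ε w ha hb hε hw hcm (eP w) (eM w) w κ κ.2)
    hmatch hU hcl hf hP

end Row

end Summit.Ventures.HodgeRepro.Tier4.Line4

end
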